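import Summits.AtomisticToContinuum.HydrodynamicLimit.Theorems.OneFlightGossipEngineClampedCurrentsDockCubicChannelPrelim
import Summits.AtomisticToContinuum.HydrodynamicLimit.Theorems.OneFlightGossipEngineKacPairHeatFlux
import HarnessLib

/-!
# The cubic channel — pathwise bound on one window in the normalisation of the true-law inputs
# (stub `stub_cubicChannel`, QC-b, line `IdeatorTwoSketch`, crux `ClampedCurrentsDock`, stmt-AtomisticToContinuum-14680)

Helper file (`--supports stmt-AtomisticToContinuum-14680`) for the registered stub QC-b `stub_cubicChannel : CubicChannel`
(companion file `…CubicChannel.lean`, which imports this one). On ONE window `[s, s+w]` of a good orbit `z`, the landed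
pathwise cubic channel QC-a (`CubicChannelPathwise`, re-declared verbatim from the line skeleton v31 and ASSUMED) is applied to
the shifted good point `Φ_s z` and every window integral is shifted back (`∫₀ʷ F(Φ_r Φ_s z) = ∫_s^{s+w} F(Φ_r z)`); the three
terms of its bound are then rewritten in the quantities the true-law inputs control (`pathwiseWindowBound`, registered):

* the peculiar third moments `Σ_i ∫‖W_i‖³ ≤ 4 ∫Σ_i‖v_i‖³ + 4 w (N+1) U³` (third moments, TM);
* the coherent term IS `w (N+1)` times the integrand of the weighted coherence input S6′ at the weight `R/C_R` and level `η/C_R`;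
* the drift term `Σ_i min(2Bb, Lb ∫‖v_i‖) ∫‖W_i‖³ ≤ Lb δ Σ_i∫‖W_i‖³ + 2Bb (w M′³/δ)(w(N+1) + ∫Σ‖v_i‖³) + 16 Bb ∫Σ_i 1{Mv<‖v_i‖}‖v_i‖³`
  (`‖W‖³ ≤ M′³ + 8·1{Mv < ‖v‖}‖v‖³`, `M′ = Mv + U`; `1{δ < ∫‖v_i‖} ≤ δ⁻¹∫‖v_i‖ ≤ δ⁻¹∫(1 + ‖v_i‖³)`, the landed
  `KacPair.le_one_add_cube`).

prover-line-stmt-AtomisticToContinuum-14680-c2-0 (stub worker QC-b).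
-/

noncomputable section

namespace Summit.AtomisticToContinuum.HydrodynamicLimit.Theorems.ClampedCurrentsDockCubicChannel

open scoped BigOperators ENNReal Classical Interval
open MeasureTheory Filter Set Topology InformationTheory
open Literature.MathematicalPhysics.KineticTheory Literature.Analysis.FluidPDE Literature.Analysis.FunctionSpaces
open Summit.AtomisticToContinuum.HydrodynamicLimit.Theses.OneFlightGossipEngine
open Summit.AtomisticToContinuum.HydrodynamicLimit.Theorems
open Summit.AtomisticToContinuum.HydrodynamicLimit.Theorems.ClampedCurrentsDockCubicChannelPrelim
open Summit.AtomisticToContinuum.HydrodynamicLimit.Theorems.HydroLimitInBandContinuity (measurable_flow_of_mem)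
open Summit.AtomisticToContinuum.HydrodynamicLimit.Theorems.ClampedCurrentsDockCubicPathwise (intervalIntegrable_orbit)

/-! ## §1 The pathwise cubic channel QC-a (verbatim from the line skeleton; an antecedent here) -/

/-- registered stub signature QC-a (antecedent of QC-b) of line IdeatorTwoSketch, crux ClampedCurrentsDock — route-internal, not a cited fact -/
def CubicChannelPathwise : Prop :=
  ∀ (σ : ℝ) (N : ℕ) (Φ : HardSphereFlow (Torus.geometry (Fin 3)) (hsDiameter σ N) (N + 1))
    (θ₀ : T3 → ℝ) (u₀ b : T3 → V3) (G : T3 × ℝ → ℝ) (Kstar C_G Bb Lb U θM η w : ℝ),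
    0 < σ → σ < 1 / 2 → 0 < Kstar → 0 ≤ C_G → 0 ≤ Bb → 0 ≤ Lb → 0 ≤ U → 0 ≤ θM → 0 < η → 0 ≤ w →
    Continuous θ₀ → Continuous u₀ → Continuous b → Continuous G → (∀ x, 0 < θ₀ x) → (∀ x, θ₀ x ≤ θM) →
    (∀ x, ‖u₀ x‖ ≤ U) → (∀ x, ‖b x‖ ≤ Bb) → (∀ x y : T3, ‖b x - b y‖ ≤ Lb * Torus.euclidDist x y) →
    (∀ y : T3 × ℝ, 0 ≤ y.2 → |G y| ≤ C_G) → (∀ (x : T3) (s' : ℝ), s' ≤ Kstar ^ 2 → G (x, s') = s' - 5 * θ₀ x) →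
    ∀ z ∈ Φ.good,
      (let W := fun (i : Fin (N + 1)) (r : ℝ) => (Φ.flow r z i).2 - u₀ (Φ.flow r z i).1
       let R := fun (x : T3) (s' : ℝ) => s' - 5 * θ₀ x - G (x, s')
       let hi := fun (y : T3 × V3) =>
         (∑ k : Fin 3, b y.1 k * (y.2 - u₀ y.1) k) * R y.1 (‖y.2 - u₀ y.1‖ ^ 2)
       let C_R : ℝ := 1 + (5 * θM + C_G) / Kstar ^ 2
       let Q := fun (i : Fin (N + 1)) (r : ℝ) => R (Φ.flow r z i).1 (‖W i r‖ ^ 2) • W i r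
       |∫ r in (0 : ℝ)..w, ∑ i : Fin (N + 1), hi (Φ.flow r z i)| ≤
         Bb * (η * (∑ i, ∫ r in (0 : ℝ)..w, ‖W i r‖ ^ 3) +
           C_R * ∑ i, (if η * ∫ r in (0 : ℝ)..w, ‖W i r‖ ^ 3 < ‖∫ r in (0 : ℝ)..w, Q i r‖ then
             ∫ r in (0 : ℝ)..w, (if Kstar < ‖W i r‖ then ‖W i r‖ ^ 3 else 0) else 0)) +
         C_R * ∑ i, min (2 * Bb) (Lb * ∫ r in (0 : ℝ)..w, ‖(Φ.flow r z i).2‖) * (∫ r in (0 : ℝ)..w, ‖W i r‖ ^ 3))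

/-! ## §2 Window functionals along an orbit and their flow shifts -/

variable {σ : ℝ} {N : ℕ}

/-- The peculiar velocity `W_i(r) = v_i(r) − u_s(x_i(r))` along the orbit of `z`. [folklore] -/
def Wv (Φ : HardSphereFlow (Torus.geometry (Fin 3)) (hsDiameter σ N) (N + 1)) (us : T3 → V3)
    (z : Config (N + 1) (Fin 3) T3) (i : Fin (N + 1)) (r : ℝ) : V3 :=
  (Φ.flow r z i).2 - us (Φ.flow r z i).1

/-- The radial remainder profile `R(x, s′) = s′ − 5θ_s(x) − G_s(x, s′)`. [folklore] -/
def Rrem (θs : T3 → ℝ) (Gs : T3 × ℝ → ℝ) (x : T3) (s' : ℝ) : ℝ :=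
  s' - 5 * θs x - Gs (x, s')

/-- The suprathermal heat-flux remainder `hi(x, v) = (b(x)·w) R(x, ‖w‖²)`, `w = v − u_s(x)`. [folklore] -/
def hiF (θs : T3 → ℝ) (us bs : T3 → V3) (Gs : T3 × ℝ → ℝ) (y : T3 × V3) : ℝ :=
  (∑ k : Fin 3, bs y.1 k * (y.2 - us y.1) k) * Rrem θs Gs y.1 (‖y.2 - us y.1‖ ^ 2)

variable (Φ : HardSphereFlow (Torus.geometry (Fin 3)) (hsDiameter σ N) (N + 1)) {z : Config (N + 1) (Fin 3) T3}

/-- Flow shift of the remainder integral. [folklore] -/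
theorem shift_hi (hz : z ∈ Φ.good) (θs : T3 → ℝ) (us bs : T3 → V3) (Gs : T3 × ℝ → ℝ) (s w : ℝ) :
    ∫ r in (0 : ℝ)..w, ∑ i : Fin (N + 1), hiF θs us bs Gs (Φ.flow r (Φ.flow s z) i) =
      ∫ r in s..(s + w), ∑ i : Fin (N + 1), hiF θs us bs Gs (Φ.flow r z i) :=
  integral_window_shift Φ hz (fun c => ∑ i : Fin (N + 1), hiF θs us bs Gs (c i)) s w

/-- Flow shift of the peculiar third moment. [folklore] -/
theorem shift_cube (hz : z ∈ Φ.good) (us : T3 → V3) (i : Fin (N + 1)) (s w : ℝ) :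
    ∫ r in (0 : ℝ)..w, ‖Wv Φ us (Φ.flow s z) i r‖ ^ 3 = ∫ r in s..(s + w), ‖Wv Φ us z i r‖ ^ 3 :=
  integral_window_shift Φ hz (fun c => ‖(c i).2 - us (c i).1‖ ^ 3) s w

/-- Flow shift of the suprathermal peculiar third moment. [folklore] -/
theorem shift_cubeHi (hz : z ∈ Φ.good) (us : T3 → V3) (Kstar : ℝ) (i : Fin (N + 1)) (s w : ℝ) :
    ∫ r in (0 : ℝ)..w, (if Kstar < ‖Wv Φ us (Φ.flow s z) i r‖ then ‖Wv Φ us (Φ.flow s z) i r‖ ^ 3 else 0) =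
      ∫ r in s..(s + w), (if Kstar < ‖Wv Φ us z i r‖ then ‖Wv Φ us z i r‖ ^ 3 else 0) :=
  integral_window_shift Φ hz (fun c => if Kstar < ‖(c i).2 - us (c i).1‖ then ‖(c i).2 - us (c i).1‖ ^ 3 else 0) s w

/-- Flow shift of the weighted transport. [folklore] -/
theorem shift_Q (hz : z ∈ Φ.good) (θs : T3 → ℝ) (us : T3 → V3) (Gs : T3 × ℝ → ℝ) (i : Fin (N + 1)) (s w : ℝ) :
    ∫ r in (0 : ℝ)..w, Rrem θs Gs (Φ.flow r (Φ.flow s z) i).1 (‖Wv Φ us (Φ.flow s z) i r‖ ^ 2) •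
        Wv Φ us (Φ.flow s z) i r =
      ∫ r in s..(s + w), Rrem θs Gs (Φ.flow r z i).1 (‖Wv Φ us z i r‖ ^ 2) • Wv Φ us z i r :=
  integral_window_shift Φ hz
    (fun c => Rrem θs Gs (c i).1 (‖(c i).2 - us (c i).1‖ ^ 2) • ((c i).2 - us (c i).1)) s w

/-- Flow shift of the path length. [folklore] -/
theorem shift_speed (hz : z ∈ Φ.good) (i : Fin (N + 1)) (s w : ℝ) :
    ∫ r in (0 : ℝ)..w, ‖(Φ.flow r (Φ.flow s z) i).2‖ = ∫ r in s..(s + w), ‖(Φ.flow r z i).2‖ :=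
  integral_window_shift Φ hz (fun c => ‖(c i).2‖) s w

/-! ## §3 Elementary pointwise inequalities of the cubic bookkeeping -/

/-- Peculiar third moment against the absolute one: `‖v − a‖³ ≤ 4(‖v‖³ + U³)` for `‖a‖ ≤ U`. [folklore] -/
theorem norm_sub_cube_le_four {v a : V3} {U : ℝ} (hU : 0 ≤ U) (ha : ‖a‖ ≤ U) :
    ‖v - a‖ ^ 3 ≤ 4 * (‖v‖ ^ 3 + U ^ 3) := by
  have h1 : ‖v - a‖ ≤ ‖v‖ + U := (norm_sub_le _ _).trans (add_le_add le_rfl ha)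
  have hv := norm_nonneg v
  have h2 : ‖v - a‖ ^ 3 ≤ (‖v‖ + U) ^ 3 := pow_le_pow_left₀ (norm_nonneg _) h1 3
  nlinarith [mul_nonneg (sq_nonneg (‖v‖ - U)) (add_nonneg hv hU)]

/-- Peculiar third moment above a level: for `‖a‖ ≤ U ≤ Mv`, `‖v − a‖³ ≤ (Mv + U)³ + 8 · 1{Mv < ‖v‖}‖v‖³`. [folklore] -/
theorem norm_sub_cube_le_tail {v a : V3} {U Mv : ℝ} (hU : 0 ≤ U) (ha : ‖a‖ ≤ U) (hMv : U ≤ Mv) :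
    ‖v - a‖ ^ 3 ≤ (Mv + U) ^ 3 + 8 * Set.indicator {w : V3 | Mv < ‖w‖} (fun w => ‖w‖ ^ 3) v := by
  have hI0 : 0 ≤ Set.indicator {w : V3 | Mv < ‖w‖} (fun w => ‖w‖ ^ 3) v :=
    Set.indicator_nonneg (fun _ _ => by positivity) _
  rcases le_or_gt ‖v - a‖ (Mv + U) with h | h
  · exact (pow_le_pow_left₀ (norm_nonneg _) h 3).trans (le_add_of_nonneg_right (by positivity))
  · have hva : ‖v - a‖ ≤ ‖v‖ + ‖a‖ := norm_sub_le v a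
    have hv : Mv < ‖v‖ := by linarith
    rw [Set.indicator_of_mem (show v ∈ {w : V3 | Mv < ‖w‖} from hv)]
    have h2 : ‖v - a‖ ≤ 2 * ‖v‖ := by linarith
    have h3 : ‖v - a‖ ^ 3 ≤ (2 * ‖v‖) ^ 3 := pow_le_pow_left₀ (norm_nonneg _) h2 3
    have hMU : 0 ≤ Mv + U := by linarith
    nlinarith [pow_nonneg hMU 3]

/-- **The drift term.** With `C ≤ A + 8T` (`A = w M′³`, `T` the tail integral) and `D` the path length:
`min(2Bb, Lb D) C ≤ Lb δ C + 2Bb (A/δ) D + 16 Bb T` (small displacement `D ≤ δ` pays `Lb δ`, a large one is counted by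
`1{δ < D} ≤ D/δ`). [folklore] -/
theorem drift_term_le {Bb Lb δ D C A T : ℝ} (hBb : 0 ≤ Bb) (hLb : 0 ≤ Lb) (hδ : 0 < δ) (hD : 0 ≤ D) (hC : 0 ≤ C)
    (hA : 0 ≤ A) (hT : 0 ≤ T) (hCle : C ≤ A + 8 * T) :
    min (2 * Bb) (Lb * D) * C ≤ Lb * δ * C + 2 * Bb * (A / δ) * D + 16 * Bb * T := by
  have h0 : 0 ≤ 2 * Bb * (A / δ) * D + 16 * Bb * T := by positivity
  rcases le_or_gt D δ with h | h
  · calc min (2 * Bb) (Lb * D) * C ≤ Lb * D * C := mul_le_mul_of_nonneg_right (min_le_right _ _) hC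
      _ ≤ Lb * δ * C := mul_le_mul_of_nonneg_right (mul_le_mul_of_nonneg_left h hLb) hC
      _ ≤ Lb * δ * C + 2 * Bb * (A / δ) * D + 16 * Bb * T := by linarith
  · have hDδ : 1 ≤ D / δ := by rw [le_div_iff₀ hδ, one_mul]; exact h.le
    have h1 : 0 ≤ Lb * δ * C := by positivity
    have h2 : A ≤ A * (D / δ) := by nlinarith
    calc min (2 * Bb) (Lb * D) * C ≤ 2 * Bb * C := mul_le_mul_of_nonneg_right (min_le_left _ _) hC
      _ ≤ 2 * Bb * (A + 8 * T) := mul_le_mul_of_nonneg_left hCle (by positivity)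
      _ ≤ 2 * Bb * (A * (D / δ) + 8 * T) := mul_le_mul_of_nonneg_left (add_le_add h2 le_rfl) (by positivity)
      _ = 2 * Bb * (A / δ) * D + 16 * Bb * T := by ring
      _ ≤ Lb * δ * C + 2 * Bb * (A / δ) * D + 16 * Bb * T := by linarith

/-- **The coherent term in the normalisation of S6′.** With the window averages `cub = w⁻¹ C`, `cubHi = w⁻¹ H` and the
weighted transport `q̄ = w⁻¹ • (C_R⁻¹ • ∫Q)`, the coherence test `(η/C_R) cub < ‖q̄‖` is the test `η C < ‖∫Q‖`, and the
content paid is `w · cubHi`. [folklore] -/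
theorem coherent_term_eq {w C η Cq Hq : ℝ} (hw : 0 < w) (hC : 0 < C) (I : V3) :
    (if η * Cq < ‖I‖ then Hq else 0) =
      w * (if η / C * (w⁻¹ * Cq) < ‖w⁻¹ • (C⁻¹ • I)‖ then w⁻¹ * Hq else 0) := by
  have hnorm : ‖w⁻¹ • (C⁻¹ • I)‖ = w⁻¹ * C⁻¹ * ‖I‖ := by
    rw [norm_smul, norm_smul, Real.norm_of_nonneg (inv_nonneg.2 hw.le), Real.norm_of_nonneg (inv_nonneg.2 hC.le),
      mul_assoc]
  have hpos : 0 < w⁻¹ * C⁻¹ := by positivity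
  have hiff : η / C * (w⁻¹ * Cq) < ‖w⁻¹ • (C⁻¹ • I)‖ ↔ η * Cq < ‖I‖ := by
    rw [hnorm, show η / C * (w⁻¹ * Cq) = w⁻¹ * C⁻¹ * (η * Cq) by ring]
    exact ⟨fun h => lt_of_mul_lt_mul_left h hpos.le, fun h => mul_lt_mul_of_pos_left h hpos⟩
  by_cases h : η * Cq < ‖I‖
  · rw [if_pos h, if_pos (hiff.2 h), ← mul_assoc, mul_inv_cancel₀ hw.ne', one_mul]
  · rw [if_neg h, if_neg (mt hiff.1 h), mul_zero]

/-! ## §4 The pathwise bound on one window, in the normalisation of the true-law inputs -/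

/-- registered support signature (QC-b, pathwise half) of line IdeatorTwoSketch, crux ClampedCurrentsDock — route-internal, not a cited fact -/
def PathwiseWindowBound : Prop :=
  CubicChannelPathwise →
  ∀ (σ : ℝ) (N : ℕ) (Φ : HardSphereFlow (Torus.geometry (Fin 3)) (hsDiameter σ N) (N + 1))
    (θs : T3 → ℝ) (us bs : T3 → V3) (Gs : T3 × ℝ → ℝ) (Kstar C_G Bb Lb U θM η s w Mv δ : ℝ),
    0 < σ → σ < 1 / 2 → 0 < Kstar → 0 ≤ C_G → 0 ≤ Bb → 0 ≤ Lb → 0 ≤ U → 0 ≤ θM → 0 < η → 0 < w → U ≤ Mv → 0 < δ →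
    Continuous θs → Continuous us → Continuous bs → Continuous Gs → (∀ x, 0 < θs x) → (∀ x, θs x ≤ θM) →
    (∀ x, ‖us x‖ ≤ U) → (∀ x, ‖bs x‖ ≤ Bb) → (∀ x y : T3, ‖bs x - bs y‖ ≤ Lb * Torus.euclidDist x y) →
    (∀ y : T3 × ℝ, 0 ≤ y.2 → |Gs y| ≤ C_G) → (∀ (x : T3) (s' : ℝ), s' ≤ Kstar ^ 2 → Gs (x, s') = s' - 5 * θs x) →
    ∀ z ∈ Φ.good,
      (let C_R : ℝ := 1 + (5 * θM + C_G) / Kstar ^ 2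
       |∫ r in s..(s + w), ∑ i : Fin (N + 1), hiF θs us bs Gs (Φ.flow r z i)| ≤
         (4 * (Bb * η + C_R * Lb * δ) + 2 * C_R * Bb * (w * (Mv + U) ^ 3 / δ)) *
             (∫ r in s..(s + w), ∑ i : Fin (N + 1), ‖(Φ.flow r z i).2‖ ^ 3) +
           (4 * (Bb * η + C_R * Lb * δ) * (w * ((N : ℝ) + 1) * U ^ 3) +
             2 * C_R * Bb * (w * (Mv + U) ^ 3 / δ) * (w * ((N : ℝ) + 1))) +
           16 * C_R * Bb * (∫ r in s..(s + w), ∑ i : Fin (N + 1),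
             Set.indicator {v : V3 | Mv < ‖v‖} (fun v => ‖v‖ ^ 3) ((Φ.flow r z i).2)) +
           Bb * C_R * (w * ((N : ℝ) + 1)) * (((N : ℝ) + 1)⁻¹ * ∑ i : Fin (N + 1),
             (if η / C_R * (w⁻¹ * ∫ r in s..(s + w), ‖Wv Φ us z i r‖ ^ 3) <
                 ‖w⁻¹ • ∫ r in s..(s + w),
                   (Rrem θs Gs (Φ.flow r z i).1 (‖Wv Φ us z i r‖ ^ 2) / C_R) • Wv Φ us z i r‖ then
               w⁻¹ * ∫ r in s..(s + w), (if Kstar < ‖Wv Φ us z i r‖ then ‖Wv Φ us z i r‖ ^ 3 else 0)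
             else 0)))

/-- **The pathwise cubic channel on the window `[s, s+w]`, in the normalisation of the true-law inputs** (registered
support theorem of line `IdeatorTwoSketch`): QC-a at the shifted good point `Φ_s z`, the flow shift of every window
integral, then the bookkeeping of §3 integrated along the good orbit (all integrands are measurable in time and bounded).
[folklore] -/
theorem pathwiseWindowBound : PathwiseWindowBound := by
  intro hQC σ N Φ θs us bs Gs Kstar C_G Bb Lb U θM η s w Mv δ hσ hσ2 hK hCG hBb hLb hU hθM hη hw hUMv hδ
    hθc huc hbc hGc hθpos hθle hule hble hblip hGb hGa z hz C_R
  have hCR : 0 < C_R := by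
    show 0 < 1 + (5 * θM + C_G) / Kstar ^ 2
    positivity
  have hsw : s ≤ s + w := by linarith
  have hN : (0 : ℝ) < (N : ℝ) + 1 := by positivity
  have hz' : Φ.flow s z ∈ Φ.good := Φ.mapsTo_good s hz
  -- QC-a on the shifted orbit, every window integral shifted back to `[s, s+w]`
  have hq : |∫ r in (0 : ℝ)..w, ∑ i : Fin (N + 1), hiF θs us bs Gs (Φ.flow r (Φ.flow s z) i)| ≤
      Bb * (η * (∑ i, ∫ r in (0 : ℝ)..w, ‖Wv Φ us (Φ.flow s z) i r‖ ^ 3) +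
        C_R * ∑ i, (if η * ∫ r in (0 : ℝ)..w, ‖Wv Φ us (Φ.flow s z) i r‖ ^ 3 <
            ‖∫ r in (0 : ℝ)..w, Rrem θs Gs (Φ.flow r (Φ.flow s z) i).1 (‖Wv Φ us (Φ.flow s z) i r‖ ^ 2) •
              Wv Φ us (Φ.flow s z) i r‖ then
          ∫ r in (0 : ℝ)..w, (if Kstar < ‖Wv Φ us (Φ.flow s z) i r‖ then ‖Wv Φ us (Φ.flow s z) i r‖ ^ 3 else 0)
          else 0)) +
      C_R * ∑ i, min (2 * Bb) (Lb * ∫ r in (0 : ℝ)..w, ‖(Φ.flow r (Φ.flow s z) i).2‖) *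
        (∫ r in (0 : ℝ)..w, ‖Wv Φ us (Φ.flow s z) i r‖ ^ 3) :=
    hQC σ N Φ θs us bs Gs Kstar C_G Bb Lb U θM η w hσ hσ2 hK hCG hBb hLb hU hθM hη hw.le hθc huc hbc hGc hθpos hθle
      hule hble hblip hGb hGa (Φ.flow s z) hz'
  simp only [shift_hi Φ hz, shift_cube Φ hz, shift_cubeHi Φ hz, shift_Q Φ hz, shift_speed Φ hz] at hq
  -- integrability along the good orbit
  have hW3i : ∀ i, IntervalIntegrable (fun r => ‖Wv Φ us z i r‖ ^ 3) volume s (s + w) := fun i =>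
    intervalIntegrable_orbit Φ hz (F := fun y : T3 × V3 => ‖y.2 - us y.1‖ ^ 3) (by fun_prop) i s (s + w)
  have hv3i : ∀ i, IntervalIntegrable (fun r => ‖(Φ.flow r z i).2‖ ^ 3) volume s (s + w) := fun i =>
    intervalIntegrable_orbit Φ hz (F := fun y : T3 × V3 => ‖y.2‖ ^ 3) (by fun_prop) i s (s + w)
  have hv1i : ∀ i, IntervalIntegrable (fun r => ‖(Φ.flow r z i).2‖) volume s (s + w) := fun i =>
    intervalIntegrable_orbit Φ hz (F := fun y : T3 × V3 => ‖y.2‖) (by fun_prop) i s (s + w)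
  have hTi : ∀ i, IntervalIntegrable
      (fun r => Set.indicator {v : V3 | Mv < ‖v‖} (fun v => ‖v‖ ^ 3) (Φ.flow r z i).2) volume s (s + w) := by
    intro i
    refine (hv3i i).mono_fun ?_ (Eventually.of_forall fun r => ?_)
    · exact ((((measurable_norm.pow_const 3).indicator (measurableSet_lt measurable_const measurable_norm)).comp
        ((measurable_pi_apply i).comp (measurable_flow_of_mem Φ hz)).snd)).aestronglyMeasurable
    · show ‖Set.indicator {v : V3 | Mv < ‖v‖} (fun v => ‖v‖ ^ 3) (Φ.flow r z i).2‖ ≤ ‖‖(Φ.flow r z i).2‖ ^ 3‖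
      rw [Real.norm_of_nonneg (Set.indicator_nonneg (fun _ _ => by positivity) _), Real.norm_of_nonneg (by positivity)]
      exact Set.indicator_le_self' (fun _ _ => by positivity) _
  -- nonnegativity of the window integrals
  have hI30 : ∀ i, 0 ≤ ∫ r in s..(s + w), ‖Wv Φ us z i r‖ ^ 3 := fun i =>
    intervalIntegral.integral_nonneg hsw fun r _ => by positivity
  have hIT0 : ∀ i, 0 ≤ ∫ r in s..(s + w), Set.indicator {v : V3 | Mv < ‖v‖} (fun v => ‖v‖ ^ 3) (Φ.flow r z i).2 :=
    fun i => intervalIntegral.integral_nonneg hsw fun r _ => Set.indicator_nonneg (fun _ _ => by positivity) _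
  have hID0 : ∀ i, 0 ≤ ∫ r in s..(s + w), ‖(Φ.flow r z i).2‖ := fun i =>
    intervalIntegral.integral_nonneg hsw fun r _ => norm_nonneg _
  have hIv0 : ∀ i, 0 ≤ ∫ r in s..(s + w), ‖(Φ.flow r z i).2‖ ^ 3 := fun i =>
    intervalIntegral.integral_nonneg hsw fun r _ => by positivity
  -- (i) peculiar third moments against absolute ones
  have hI3le : ∀ i, ∫ r in s..(s + w), ‖Wv Φ us z i r‖ ^ 3 ≤
      4 * (∫ r in s..(s + w), ‖(Φ.flow r z i).2‖ ^ 3) + 4 * (w * U ^ 3) := by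
    intro i
    calc ∫ r in s..(s + w), ‖Wv Φ us z i r‖ ^ 3 ≤ ∫ r in s..(s + w), 4 * (‖(Φ.flow r z i).2‖ ^ 3 + U ^ 3) :=
          intervalIntegral.integral_mono_on hsw (hW3i i) (((hv3i i).add intervalIntegrable_const).const_mul 4)
            fun r _ => norm_sub_cube_le_four hU (hule _)
      _ = 4 * (∫ r in s..(s + w), ‖(Φ.flow r z i).2‖ ^ 3) + 4 * (w * U ^ 3) := by
          rw [intervalIntegral.integral_const_mul, intervalIntegral.integral_add (hv3i i) intervalIntegrable_const,
            intervalIntegral.integral_const, add_sub_cancel_left, smul_eq_mul, mul_add]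
  -- (ii) peculiar third moments above the level `Mv + U`
  have hI3tail : ∀ i, ∫ r in s..(s + w), ‖Wv Φ us z i r‖ ^ 3 ≤
      w * (Mv + U) ^ 3 + 8 * ∫ r in s..(s + w), Set.indicator {v : V3 | Mv < ‖v‖} (fun v => ‖v‖ ^ 3) (Φ.flow r z i).2 := by
    intro i
    calc ∫ r in s..(s + w), ‖Wv Φ us z i r‖ ^ 3 ≤ ∫ r in s..(s + w),
          ((Mv + U) ^ 3 + 8 * Set.indicator {v : V3 | Mv < ‖v‖} (fun v => ‖v‖ ^ 3) (Φ.flow r z i).2) :=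
          intervalIntegral.integral_mono_on hsw (hW3i i) (intervalIntegrable_const.add ((hTi i).const_mul 8))
            fun r _ => norm_sub_cube_le_tail hU (hule _) hUMv
      _ = w * (Mv + U) ^ 3 + 8 * ∫ r in s..(s + w), Set.indicator {v : V3 | Mv < ‖v‖} (fun v => ‖v‖ ^ 3)
            (Φ.flow r z i).2 := by
          rw [intervalIntegral.integral_add intervalIntegrable_const ((hTi i).const_mul 8),
            intervalIntegral.integral_const, intervalIntegral.integral_const_mul, add_sub_cancel_left, smul_eq_mul]
  -- (iii) path length against the cubic moment
  have hIDle : ∀ i, ∫ r in s..(s + w), ‖(Φ.flow r z i).2‖ ≤ w + ∫ r in s..(s + w), ‖(Φ.flow r z i).2‖ ^ 3 := by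
    intro i
    calc ∫ r in s..(s + w), ‖(Φ.flow r z i).2‖ ≤ ∫ r in s..(s + w), (1 + ‖(Φ.flow r z i).2‖ ^ 3) :=
          intervalIntegral.integral_mono_on hsw (hv1i i) (intervalIntegrable_const.add (hv3i i))
            fun r _ => KacPair.le_one_add_cube (norm_nonneg _)
      _ = w + ∫ r in s..(s + w), ‖(Φ.flow r z i).2‖ ^ 3 := by
          rw [intervalIntegral.integral_add intervalIntegrable_const (hv3i i), intervalIntegral.integral_const,
            add_sub_cancel_left, smul_eq_mul, mul_one]
  -- sums over particles
  have hVsum : ∑ i, ∫ r in s..(s + w), ‖(Φ.flow r z i).2‖ ^ 3 = ∫ r in s..(s + w), ∑ i, ‖(Φ.flow r z i).2‖ ^ 3 :=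
    (intervalIntegral.integral_finsetSum fun i _ => hv3i i).symm
  have hTsum : ∑ i, ∫ r in s..(s + w), Set.indicator {v : V3 | Mv < ‖v‖} (fun v => ‖v‖ ^ 3) (Φ.flow r z i).2 =
      ∫ r in s..(s + w), ∑ i, Set.indicator {v : V3 | Mv < ‖v‖} (fun v => ‖v‖ ^ 3) (Φ.flow r z i).2 :=
    (intervalIntegral.integral_finsetSum fun i _ => hTi i).symm
  have hA : ∑ i, ∫ r in s..(s + w), ‖Wv Φ us z i r‖ ^ 3 ≤
      4 * (∫ r in s..(s + w), ∑ i, ‖(Φ.flow r z i).2‖ ^ 3) + 4 * (w * ((N : ℝ) + 1) * U ^ 3) := by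
    calc ∑ i, ∫ r in s..(s + w), ‖Wv Φ us z i r‖ ^ 3
        ≤ ∑ i, (4 * (∫ r in s..(s + w), ‖(Φ.flow r z i).2‖ ^ 3) + 4 * (w * U ^ 3)) :=
          Finset.sum_le_sum fun i _ => hI3le i
      _ = 4 * (∫ r in s..(s + w), ∑ i, ‖(Φ.flow r z i).2‖ ^ 3) + 4 * (w * ((N : ℝ) + 1) * U ^ 3) := by
          rw [Finset.sum_add_distrib, ← Finset.mul_sum, hVsum, Finset.sum_const, Finset.card_univ, Fintype.card_fin,
            nsmul_eq_mul]
          push_cast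
          ring
  have hDsum : ∑ i, ∫ r in s..(s + w), ‖(Φ.flow r z i).2‖ ≤
      w * ((N : ℝ) + 1) + ∫ r in s..(s + w), ∑ i, ‖(Φ.flow r z i).2‖ ^ 3 := by
    calc ∑ i, ∫ r in s..(s + w), ‖(Φ.flow r z i).2‖ ≤ ∑ i, (w + ∫ r in s..(s + w), ‖(Φ.flow r z i).2‖ ^ 3) :=
          Finset.sum_le_sum fun i _ => hIDle i
      _ = w * ((N : ℝ) + 1) + ∫ r in s..(s + w), ∑ i, ‖(Φ.flow r z i).2‖ ^ 3 := by
          rw [Finset.sum_add_distrib, hVsum, Finset.sum_const, Finset.card_univ, Fintype.card_fin, nsmul_eq_mul]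
          push_cast
          ring
  -- the coherent term in the normalisation of S6′
  have hQ : ∀ i, ∫ r in s..(s + w), (Rrem θs Gs (Φ.flow r z i).1 (‖Wv Φ us z i r‖ ^ 2) / C_R) • Wv Φ us z i r =
      C_R⁻¹ • ∫ r in s..(s + w), Rrem θs Gs (Φ.flow r z i).1 (‖Wv Φ us z i r‖ ^ 2) • Wv Φ us z i r := by
    intro i
    rw [← intervalIntegral.integral_smul]
    refine intervalIntegral.integral_congr fun r _ => ?_
    show (Rrem θs Gs (Φ.flow r z i).1 (‖Wv Φ us z i r‖ ^ 2) / C_R) • Wv Φ us z i r =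
      C_R⁻¹ • (Rrem θs Gs (Φ.flow r z i).1 (‖Wv Φ us z i r‖ ^ 2) • Wv Φ us z i r)
    rw [div_eq_inv_mul, mul_smul]
  have hB : ∀ i, (if η * ∫ r in s..(s + w), ‖Wv Φ us z i r‖ ^ 3 <
        ‖∫ r in s..(s + w), Rrem θs Gs (Φ.flow r z i).1 (‖Wv Φ us z i r‖ ^ 2) • Wv Φ us z i r‖ then
        ∫ r in s..(s + w), (if Kstar < ‖Wv Φ us z i r‖ then ‖Wv Φ us z i r‖ ^ 3 else 0) else 0) =
      w * (if η / C_R * (w⁻¹ * ∫ r in s..(s + w), ‖Wv Φ us z i r‖ ^ 3) <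
          ‖w⁻¹ • ∫ r in s..(s + w), (Rrem θs Gs (Φ.flow r z i).1 (‖Wv Φ us z i r‖ ^ 2) / C_R) • Wv Φ us z i r‖ then
        w⁻¹ * ∫ r in s..(s + w), (if Kstar < ‖Wv Φ us z i r‖ then ‖Wv Φ us z i r‖ ^ 3 else 0) else 0) := by
    intro i
    rw [hQ i]
    exact coherent_term_eq hw hCR _
  have hBsum : (∑ i, (if η * ∫ r in s..(s + w), ‖Wv Φ us z i r‖ ^ 3 <
        ‖∫ r in s..(s + w), Rrem θs Gs (Φ.flow r z i).1 (‖Wv Φ us z i r‖ ^ 2) • Wv Φ us z i r‖ then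
        ∫ r in s..(s + w), (if Kstar < ‖Wv Φ us z i r‖ then ‖Wv Φ us z i r‖ ^ 3 else 0) else 0)) =
      w * ((N : ℝ) + 1) * (((N : ℝ) + 1)⁻¹ * ∑ i, (if η / C_R * (w⁻¹ * ∫ r in s..(s + w), ‖Wv Φ us z i r‖ ^ 3) <
          ‖w⁻¹ • ∫ r in s..(s + w), (Rrem θs Gs (Φ.flow r z i).1 (‖Wv Φ us z i r‖ ^ 2) / C_R) • Wv Φ us z i r‖ then
        w⁻¹ * ∫ r in s..(s + w), (if Kstar < ‖Wv Φ us z i r‖ then ‖Wv Φ us z i r‖ ^ 3 else 0) else 0)) := by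
    rw [Finset.sum_congr rfl fun i _ => hB i, ← Finset.mul_sum, ← mul_assoc, mul_assoc w, mul_inv_cancel₀ hN.ne',
      mul_one]
  -- the drift term
  have hA₀ : 0 ≤ w * (Mv + U) ^ 3 := mul_nonneg hw.le (pow_nonneg (by linarith) 3)
  have hD : ∀ i, min (2 * Bb) (Lb * ∫ r in s..(s + w), ‖(Φ.flow r z i).2‖) * (∫ r in s..(s + w), ‖Wv Φ us z i r‖ ^ 3) ≤
      Lb * δ * (∫ r in s..(s + w), ‖Wv Φ us z i r‖ ^ 3) +
        2 * Bb * (w * (Mv + U) ^ 3 / δ) * (∫ r in s..(s + w), ‖(Φ.flow r z i).2‖) +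
        16 * Bb * ∫ r in s..(s + w), Set.indicator {v : V3 | Mv < ‖v‖} (fun v => ‖v‖ ^ 3) (Φ.flow r z i).2 :=
    fun i => drift_term_le hBb hLb hδ (hID0 i) (hI30 i) hA₀ (hIT0 i) (hI3tail i)
  have hDle : ∑ i, min (2 * Bb) (Lb * ∫ r in s..(s + w), ‖(Φ.flow r z i).2‖) * (∫ r in s..(s + w), ‖Wv Φ us z i r‖ ^ 3) ≤
      Lb * δ * (∑ i, ∫ r in s..(s + w), ‖Wv Φ us z i r‖ ^ 3) +
        2 * Bb * (w * (Mv + U) ^ 3 / δ) * (w * ((N : ℝ) + 1) + ∫ r in s..(s + w), ∑ i, ‖(Φ.flow r z i).2‖ ^ 3) +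
        16 * Bb * ∫ r in s..(s + w), ∑ i, Set.indicator {v : V3 | Mv < ‖v‖} (fun v => ‖v‖ ^ 3) (Φ.flow r z i).2 := by
    have hc : 0 ≤ 2 * Bb * (w * (Mv + U) ^ 3 / δ) := mul_nonneg (mul_nonneg two_pos.le hBb) (div_nonneg hA₀ hδ.le)
    calc ∑ i, min (2 * Bb) (Lb * ∫ r in s..(s + w), ‖(Φ.flow r z i).2‖) * (∫ r in s..(s + w), ‖Wv Φ us z i r‖ ^ 3)
        ≤ ∑ i, (Lb * δ * (∫ r in s..(s + w), ‖Wv Φ us z i r‖ ^ 3) +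
            2 * Bb * (w * (Mv + U) ^ 3 / δ) * (∫ r in s..(s + w), ‖(Φ.flow r z i).2‖) +
            16 * Bb * ∫ r in s..(s + w), Set.indicator {v : V3 | Mv < ‖v‖} (fun v => ‖v‖ ^ 3) (Φ.flow r z i).2) :=
          Finset.sum_le_sum fun i _ => hD i
      _ = Lb * δ * (∑ i, ∫ r in s..(s + w), ‖Wv Φ us z i r‖ ^ 3) +
            2 * Bb * (w * (Mv + U) ^ 3 / δ) * (∑ i, ∫ r in s..(s + w), ‖(Φ.flow r z i).2‖) +
            16 * Bb * ∑ i, ∫ r in s..(s + w), Set.indicator {v : V3 | Mv < ‖v‖} (fun v => ‖v‖ ^ 3) (Φ.flow r z i).2 := by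
          rw [Finset.sum_add_distrib, Finset.sum_add_distrib, ← Finset.mul_sum, ← Finset.mul_sum, ← Finset.mul_sum]
      _ ≤ _ := by
          rw [hTsum]
          exact add_le_add (add_le_add le_rfl (mul_le_mul_of_nonneg_left hDsum hc)) le_rfl
  -- assembling
  have hc1 : 0 ≤ Bb * η := by positivity
  have hc2 : 0 ≤ C_R * Lb * δ := by positivity
  have p1 := mul_le_mul_of_nonneg_left hA hc1
  have p2 := mul_le_mul_of_nonneg_left hA hc2
  have p3 := mul_le_mul_of_nonneg_left hDle hCR.le
  have hsum0 : 0 ≤ ∑ i, ∫ r in s..(s + w), ‖Wv Φ us z i r‖ ^ 3 := Finset.sum_nonneg fun i _ => hI30 i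
  rw [hBsum] at hq
  linarith [hq, p1, p2, p3]

end Summit.AtomisticToContinuum.HydrodynamicLimit.Theorems.ClampedCurrentsDockCubicChannel

end
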